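import Mathlib.Analysis.Calculus.BumpFunction.Convolution
import Mathlib.Analysis.Calculus.BumpFunction.FiniteDimension
import Mathlib.Topology.MetricSpace.Thickening
import Literature.Analysis.FunctionSpaces.ContDiffHolderSpace
import Literature.Analysis.FunctionSpaces.HolderAlgebra
import HarnessLib

/-!
# Mollification in `C^{0,r}`: smooth approximation preserving Hölder bounds (Hölder spaces, part 20)

Topic `Literature/Analysis/FunctionSpaces`. The standard mollifier argument
(Gilbarg–Trudinger 2001, §7.2, Lemma 7.1 ff.): convolving a bounded `r`-Hölder function `f` on a
finite-dimensional space with a normed bump function of radius `ε` gives a `C^∞` function `g`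
with the SAME sup bound and the SAME Hölder constant, with `dist (g x) (f x) ≤ C ε^r`, and with
support in the `ε`-thickening of the support of `f`:

* `exists_contDiff_approx_of_holderWith` — the measure-free statement (the `HolderWith`
  conclusion is assembled with `holderWith_of_dist_le` of `HolderAlgebra.lean`);
* `ContDiffHolderFunction.holderWith_of_zero`, `norm_mk_le_of_bounds_zero` — bookkeeping
  between `HolderWith` data and the `C^{0,r}_b`-norm of part 3;
* `ContDiffHolderFunction.exists_contDiff_approx` — for `f ∈ C^{0,r}_b(E, F)`: smooth `g` with
  `‖g‖_{C^{0,r}} ≤ 2‖f‖`, `‖g − f‖_∞ ≤ ‖f‖ ε^r`, `tsupport g ⊆ cthickening ε (tsupport f)`.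

This is the approximation step of the surjectivity argument (census item (2c) of
`Literature.Geometry.Riemannian.gurskyViaclovsky_pathOpen_weighted_four`: `C^{0,α}` data are
uniform limits of smooth data with bounded Hölder norms). Everything is proved; no named facts.

## References

* D. Gilbarg, N. S. Trudinger, *Elliptic Partial Differential Equations of Second Order* (2001),
  §7.2. [GilbargTrudinger2001]
-/

noncomputable section

open Set Filter Metric MeasureTheory Function
open scoped NNReal ENNReal Topology Convolution ContDiff

namespace Literature.Analysis.FunctionSpaces

variable {E F : Type*} [NormedAddCommGroup E] [NormedSpace ℝ E] [FiniteDimensional ℝ E]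
  [NormedAddCommGroup F] [NormedSpace ℝ F] [CompleteSpace F]

/-- **Mollification of a bounded Hölder function.** For `f : E → F` continuous with
`‖f‖ ≤ A` and `HolderWith C r f`, and `ε > 0`, there is a `C^∞` function `g` (the convolution of
`f` with a normed bump function supported in `B(0, ε)`) with `‖g‖ ≤ A`, `HolderWith C r g`,
`dist (g x) (f x) ≤ C ε^r` for all `x`, and `tsupport g ⊆ cthickening ε (tsupport f)`.
[cite: GilbargTrudinger2001, §7.2, Lemma 7.1] -/
theorem exists_contDiff_approx_of_holderWith {f : E → F} (hfc : Continuous f) {A : ℝ}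
    (hA : ∀ x, ‖f x‖ ≤ A) {C r : ℝ≥0} (hf : HolderWith C r f) {ε : ℝ} (hε : 0 < ε) :
    ∃ g : E → F, ContDiff ℝ ∞ g ∧ (∀ x, ‖g x‖ ≤ A) ∧ HolderWith C r g ∧
      (∀ x, dist (g x) (f x) ≤ C * ε ^ (r : ℝ)) ∧ tsupport g ⊆ cthickening ε (tsupport f) := by
  borelize E
  set μ : Measure E := Measure.addHaar
  set φ : ContDiffBump (0 : E) := ⟨ε / 2, ε, half_pos hε, half_lt_self hε⟩
  have hφr : φ.rOut = ε := rfl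
  have hmg : AEStronglyMeasurable f μ := hfc.aestronglyMeasurable
  set g : E → F := φ.normed μ ⋆[ContinuousLinearMap.lsmul ℝ ℝ, μ] f with hg
  have hA0 : 0 ≤ A := (norm_nonneg _).trans (hA 0)
  refine ⟨g, ?_, ?_, ?_, ?_, ?_⟩
  · -- smoothness
    exact φ.hasCompactSupport_normed.contDiff_convolution_left _ φ.contDiff_normed
      (hfc.locallyIntegrable (μ := μ))
  · -- sup bound
    intro x
    have h := dist_convolution_le (μ := μ) (z₀ := (0 : F)) (x₀ := x) hA0
      φ.support_normed_eq.subset φ.nonneg_normed φ.integral_normed hmg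
      (fun y _ => by rw [dist_zero_right]; exact hA y)
    rwa [dist_zero_right] at h
  · -- Hölder bound: `g x − g x' = ∫ φ t • (f (x − t) − f (x' − t))`
    have hgx : ∀ x, g x = ∫ t, φ.normed μ t • f (x - t) ∂μ := fun x => by
      simp only [hg, convolution_def, ContinuousLinearMap.lsmul_apply]
    have hint : ∀ x, Integrable (fun t => φ.normed μ t • f (x - t)) μ := fun x =>
      (φ.continuous_normed.smul (hfc.comp (continuous_const.sub continuous_id))).integrable_of_hasCompactSupport
        φ.hasCompactSupport_normed.smul_right
    refine holderWith_of_dist_le fun x y => ?_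
    rw [dist_eq_norm, hgx, hgx, ← integral_sub (hint x) (hint y)]
    have hbound : ∀ t, ‖φ.normed μ t • f (x - t) - φ.normed μ t • f (y - t)‖ ≤
        φ.normed μ t * (C * dist x y ^ (r : ℝ)) := fun t => by
      rw [← smul_sub, norm_smul, Real.norm_of_nonneg (φ.nonneg_normed t)]
      refine mul_le_mul_of_nonneg_left ?_ (φ.nonneg_normed t)
      rw [← dist_eq_norm, ← dist_sub_right x y t]
      exact hf.dist_le _ _
    refine (norm_integral_le_of_norm_le (φ.integrable_normed.mul_const _)
      (Eventually.of_forall hbound)).trans ?_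
    rw [integral_mul_const, φ.integral_normed, one_mul]
  · -- approximation
    intro x
    refine φ.dist_normed_convolution_le hmg fun y hy => ?_
    refine (hf.dist_le y x).trans (mul_le_mul_of_nonneg_left ?_ (NNReal.coe_nonneg C))
    rw [mem_ball, hφr] at hy
    exact Real.rpow_le_rpow dist_nonneg hy.le (NNReal.coe_nonneg r)
  · -- support
    have h1 : support g ⊆ thickening ε (tsupport f) := by
      refine (support_convolution_subset (L := ContinuousLinearMap.lsmul ℝ ℝ) (μ := μ)).trans ?_
      rintro y ⟨b, hb, s, hs, rfl⟩
      rw [φ.support_normed_eq, hφr, mem_ball, dist_zero_right] at hb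
      refine mem_thickening_iff.2 ⟨s, subset_tsupport _ hs, ?_⟩
      rwa [dist_eq_norm, add_sub_cancel_right]
    exact (closure_mono h1).trans (closure_thickening_subset_cthickening _ _)

/-! ### Bookkeeping with the space `C^{0,r}_b` of part 3 -/

namespace ContDiffHolderFunction

variable {r : ℝ≥0}

omit [FiniteDimensional ℝ E] [CompleteSpace F] in
/-- A member of `C^{0,r}_b` is `r`-Hölder with constant `‖f‖`. [folklore] -/
theorem holderWith_of_zero (f : ContDiffHolderFunction E F 0 r) :
    HolderWith ‖f‖₊ r (f : E → F) := by
  have h : HolderWith (nnHolderNorm r (iteratedFDeriv ℝ 0 (f : E → F))) r (f : E → F) :=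
    holderWith_iteratedFDeriv_zero_iff.1 f.memHolder.holderWith
  have h1 : nnHolderNorm r (iteratedFDeriv ℝ 0 (f : E → F)) ≤ ‖f‖₊ := by
    rw [← NNReal.coe_le_coe, coe_nnnorm]
    exact f.nnHolderNorm_le_norm
  have h2 : ((nnHolderNorm r (iteratedFDeriv ℝ 0 (f : E → F)) : ℝ≥0) : ℝ≥0∞) ≤ ((‖f‖₊ : ℝ≥0) : ℝ≥0∞) :=
    ENNReal.coe_le_coe.2 h1
  intro x y
  exact (h x y).trans (mul_le_mul' h2 le_rfl)

omit [FiniteDimensional ℝ E] [CompleteSpace F] in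
/-- A continuous function with `‖g‖ ≤ A` and `HolderWith C r g` is in `C^{0,r}_b`. [folklore] -/
theorem _root_.Literature.Analysis.FunctionSpaces.memContDiffHolder_zero_of_bounds {g : E → F}
    (hg : Continuous g) {A : ℝ} (hA : ∀ x, ‖g x‖ ≤ A) {C : ℝ≥0} (hC : HolderWith C r g) :
    MemContDiffHolder 0 r g := by
  refine ⟨by exact_mod_cast contDiff_zero.2 hg, fun j hj => ?_, memHolder_iteratedFDeriv_zero_iff.2 ⟨C, hC⟩⟩
  obtain rfl := Nat.le_zero.1 hj
  rw [eSupNorm_iteratedFDeriv_zero]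
  exact eSupNorm_lt_top_iff.2 ⟨A, hA⟩

omit [FiniteDimensional ℝ E] [CompleteSpace F] in
/-- Norm bound for such a member: `‖g‖_{C^{0,r}} ≤ A + C`. [folklore] -/
theorem norm_mk_le_of_bounds_zero {g : E → F} (hg : Continuous g) {A : ℝ} (hA : ∀ x, ‖g x‖ ≤ A)
    {C : ℝ≥0} (hC : HolderWith C r g) :
    ‖(⟨g, memContDiffHolder_zero_of_bounds hg hA hC⟩ : ContDiffHolderFunction E F 0 r)‖ ≤ A + C := by
  set G : ContDiffHolderFunction E F 0 r := ⟨g, memContDiffHolder_zero_of_bounds hg hA hC⟩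
  have hA0 : 0 ≤ A := (norm_nonneg _).trans (hA 0)
  rw [norm_def, Finset.sum_range_one]
  refine add_le_add (G.supNormDeriv_le 0 hA0 fun x => ?_) ?_
  · rw [norm_iteratedFDeriv_zero]
    exact hA x
  · exact_mod_cast (holderWith_iteratedFDeriv_zero_iff.2 hC).nnholderNorm_le

/-- **Smooth approximation in `C^{0,r}_b`.** For `f ∈ C^{0,r}_b(E, F)` (`E` finite-dimensional,
`F` complete) and `ε > 0` there is `g ∈ C^{0,r}_b(E, F)` which is `C^∞`, with
`‖g‖_{C^{0,r}} ≤ 2‖f‖_{C^{0,r}}`, `‖g(x) − f(x)‖ ≤ ‖f‖ ε^r`, and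
`tsupport g ⊆ cthickening ε (tsupport f)`. [cite: GilbargTrudinger2001, §7.2, Lemma 7.1] -/
theorem exists_contDiff_approx (f : ContDiffHolderFunction E F 0 r) {ε : ℝ} (hε : 0 < ε) :
    ∃ g : ContDiffHolderFunction E F 0 r, ContDiff ℝ ∞ (g : E → F) ∧ ‖g‖ ≤ 2 * ‖f‖ ∧
      (∀ x, ‖g x - f x‖ ≤ ‖f‖ * ε ^ (r : ℝ)) ∧
      tsupport (g : E → F) ⊆ cthickening ε (tsupport (f : E → F)) := by
  obtain ⟨g, hgs, hgA, hgC, hgd, hgsupp⟩ := exists_contDiff_approx_of_holderWith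
    f.contDiff.continuous f.norm_apply_le_norm f.holderWith_of_zero hε
  refine ⟨⟨g, memContDiffHolder_zero_of_bounds hgs.continuous hgA hgC⟩, hgs, ?_, fun x => ?_, hgsupp⟩
  · have h := norm_mk_le_of_bounds_zero (r := r) hgs.continuous hgA hgC
    rw [coe_nnnorm] at h
    linarith
  · rw [← dist_eq_norm]
    have h := hgd x
    rwa [coe_nnnorm] at h

end ContDiffHolderFunction

end Literature.Analysis.FunctionSpaces

end
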